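/-
Copyright (c) 2026 the pub-hodgecm-mathlib formalisation cell (harness21).  Prover seat hodgecm-mathlib-LH4-p08 (g0), Track A «(D-RAM) FOUR-FRAME», second seat on
U3 `stub_U3_stableLaw_RP` (dealer LH4-plan (g10) WORD #33∕#34; brick BY SIGNATURE from the first seat LH4-p10 (g0) 22:11Z «GL₃ CONDUCTOR-SQUARE COUNT», steps (a)+(b)):
the lower-triangular HNF model of a lattice of `K³` and the EXACT stability test of a unit diagonal torus element on it.  2026-09-03.
-/
import Summits.HodgeConjecture.HodgeConjecture.Theorems.F0P3cDyRamDiagonalModuleCriterion   -- ★ p855126 (LH4-p11): `mapGL_diagonal_eq_iff_sum_single_mem` (module criterion, diagonal model, exact)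
import Literature.NumberTheory.Automorphic.UnitaryLatticeTreeDual                           -- ★ `mulVec_single_mem_latt`, `mulVec_mem_latt`, `latt_le_stdLattice_iff`
import HarnessLib

/-!
# (D-RAM) «FOUR-FRAME» road, unit U3 (iii), TIER 2 SUPPORT toward the stable law (S) by the finite-ring route (S-fin): THE LOWER-TRIANGULAR HNF MODEL
# `V = [[1,0,0],[x,p,0],[y,z,r]]` OF A LATTICE OF `K³` — MEMBERSHIP, `diag(s)`-STABILITY AND NORMALISATION IN CLOSED FORM

Cell `pub/hodgecm-mathlib` (D-0151), crux H413 = `stmt-HodgeConjecture-24833` (lane `--supports … --as helper`, count-neutral), route HCCMUnconditional; tier-1 socket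
`Cruxes/H413/Lines/F0_P3c_DyRamFourFrame_U3_Laws.lean`, stubs `stub_U3_stableLaw_RP ∕ _RU` (the STABLE census law (S): `Σ_b n_tv(Γ_b) = 4(q^k − 1)∕(q − 1)`).  The first
seats' frame-free reduction (S-fin) (LH4-p10 REPORT 1∕2, MEMO `F0/P3c/LH4/LH4-p10/g0/MEMO-stableLaw-finite.v1.LH4p10g0.md`; ★ p855032 `F0P3cDyRamFixedCountDiagonalModel` (LH4-p11),
★ p855115 `F0P3cDyRamStableSumSignClasses` (LH4-p10)) turns (S) into a count of `diag(s)`-STABLE NORMALISED LATTICES `M ⊆ 𝒪³` (`pr_i M = 𝒪` for every slot) for a unit diagonal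
`s = (s₀, s₁, s₂)` with `v(s_i − s_j) = n_{ij}`; its step (3) needs the «conductor-square count» `#𝓛₀ = q^{n₀₁ + n₀₂ + n₁₂}` — the lattice form of the SPLIT `GL₃` orbital integral
of the unit element, `O_γ(1_{GL₃(𝒪)}) = |D(γ)|^{−1∕2}` [Kottwitz1986BaseChangeUnits §1; Laumon1996 Lemma (5.3.2)].  THIS FILE is the model half of that count (p10's (a)+(b)): every
such `M` is to be written in column-HNF `M = V·𝒪³`, `V = [[1,0,0],[x,p,0],[y,z,r]]` (`p = ϖ^b`, `r = ϖ^c`), and on that model the three conditions — membership, `diag(s)`-stability,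
normalisation — are EXPLICIT VALUATION INEQUALITIES in `(x, y, z, p, r)`:

* §1 `mulVec_hnf` (the model's action on coordinates) and **`mem_latt_hnf_iff`**: for `p, r ≠ 0`,
  `w ∈ V·𝒪³ ↔ |w₀| ≤ 1 ∧ |w₁ − x w₀| ≤ |p| ∧ |(w₂ − y w₀)·p − z·(w₁ − x w₀)| ≤ |p r|` (forward substitution in the triangular system `V u = w`).
* §2 **`mapGL_diagonal_latt_hnf_eq_iff`**: for a unit diagonal `T = diag(s)` (`|s_i| = 1`),
  `T·(V𝒪³) = V𝒪³ ↔ |(s₁ − s₀)x| ≤ |p| ∧ |(s₁ − s₂)z| ≤ |r| ∧ |(s₀ − s₂)·y·p + (s₁ − s₀)·x·z| ≤ |p r|`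
  — ★ p855126's exact module criterion `T·M = M ↔ ∀ w ∈ M, Σ_i (s_i − s₂) w_i e_i ∈ M`, tested on the three columns of `V` through §1 (the test is `𝒪`-linear in `w`,
  `sum_smul_single_mem_latt_iff_columns`).  With `p = ϖ^b`, `r = ϖ^c` these are LH4-p10's congruences `b ≤ n₀₁ + v(x)`, `c ≤ n₁₂ + v(z)`,
  `v((s₀−s₂)y + (s₁−s₀)xzϖ^{−b}) ≥ c`.
* §3 NORMALISATION of the model (`x, y, z, p, r ∈ 𝒪`): `V𝒪³ ≤ 𝒪³` (`latt_hnf_le_stdLattice`), slot 0 always attains a unit (`exists_mem_latt_hnf_v_zero_eq_one`),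
  slot 1 attains a unit iff `|p| = 1 ∨ |x| = 1` (`exists_mem_latt_hnf_v_one_eq_one_iff`), slot 2 iff `|r| = 1 ∨ |y| = 1 ∨ |z| = 1` (`exists_mem_latt_hnf_v_two_eq_one_iff`);
  packaged as **`normalised_latt_hnf_iff`** in the currency of LH4-p10's target `ncard_normalised_fixed_lattices_eq_pow`
  (`∀ i, (∀ w ∈ M, |w i| ≤ 1) ∧ ∃ w ∈ M, |w i| = 1`).

NOT HERE (the second file of the brief): HNF EXISTENCE∕UNIQUENESS for normalised lattices and the residue-class COUNT `Σ_{(b,c)} #{(x,y,z)} = q^{n₀₁+n₀₂+n₁₂}`.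
HONEST LABEL: HC_CM is proved only modulo the 7 printed citations (2 remaining named inputs: hLiu418 = stmt-HodgeConjecture-24832, h413 = stmt-HodgeConjecture-24833) until rung 0
closes; this file is valuation bookkeeping over an arbitrary valued field (no datum, no form), count-neutral; the census law (S) stays a PROVER TARGET.

## References
* [Kottwitz1986BaseChangeUnits] R. E. Kottwitz, *Base change for unit elements of Hecke algebras*, Compositio Math. 60 (1986), §1 pp. 240–241 (lattices fixed by a torus
  element; the split count).
* [Laumon1995] G. Laumon, *Cohomology of Drinfeld Modular Varieties I* (1996), Lemma (5.3.2) p. 136, (4.3.11) (orbital integrals of the unit as lattice counts; triangular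
  decomposition).
* [Serre1980Trees] J.-P. Serre, *Trees*, Springer (1980), Ch. II §1.1 (lattices and their Hermite normal forms).
-/

set_option autoImplicit false

noncomputable section

namespace Summit.HodgeConjecture.HodgeConjecture.Cruxes.H413.F0P3cDyRamDiagonalStableLatticeHNF

open Matrix
open Literature.NumberTheory.Automorphic Literature.NumberTheory.Automorphic.HermitianLattice
open Literature.NumberTheory.Automorphic.UnitaryLatticeTree
open Summit.HodgeConjecture.HodgeConjecture.Cruxes.H413.F0P3cDyRamDiagonalModuleCriterion (mapGL_diagonal_eq_iff_sum_single_mem)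
open scoped Valued WithZero Matrix MatrixGroups

variable {K : Type*} [Field K] [Valued K ℤᵐ⁰]

/-! ## §1  The HNF model: coordinates and membership -/

omit [Valued K ℤᵐ⁰] in
/-- The action of the HNF model `V = [[1,0,0],[x,p,0],[y,z,r]]` on coordinates: `V u = (u₀, x u₀ + p u₁, y u₀ + z u₁ + r u₂)`. [cite: Serre1980Trees, Ch. II §1.1] -/
theorem mulVec_hnf (x y z p r : K) (u : Fin 3 → K) :
    (Matrix.of ![![1, 0, 0], ![x, p, 0], ![y, z, r]]) *ᵥ u = ![u 0, x * u 0 + p * u 1, y * u 0 + z * u 1 + r * u 2] := by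
  ext i
  fin_cases i <;> simp [Matrix.mulVec, dotProduct, Fin.sum_univ_three]

/-- **MEMBERSHIP IN THE HNF LATTICE `V·𝒪³`** (`V = [[1,0,0],[x,p,0],[y,z,r]]`, `p, r ≠ 0`): forward substitution in the triangular system `V u = w` —
`w ∈ V·𝒪³ ↔ |w₀| ≤ 1 ∧ |w₁ − x w₀| ≤ |p| ∧ |(w₂ − y w₀)·p − z·(w₁ − x w₀)| ≤ |p·r|`. [cite: Serre1980Trees, Ch. II §1.1] -/
theorem mem_latt_hnf_iff (x y z : K) {p r : K} (hp : p ≠ 0) (hr : r ≠ 0) (w : Fin 3 → K) :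
    w ∈ latt (Matrix.of ![![1, 0, 0], ![x, p, 0], ![y, z, r]]) ↔
      Valued.v (w 0) ≤ 1 ∧ Valued.v (w 1 - x * w 0) ≤ Valued.v p ∧
        Valued.v ((w 2 - y * w 0) * p - z * (w 1 - x * w 0)) ≤ Valued.v (p * r) := by
  have hvp : 0 < Valued.v p := (Valuation.pos_iff _).2 hp
  have hvr : 0 < Valued.v r := (Valuation.pos_iff _).2 hr
  rw [latt, Submodule.mem_map]
  constructor
  · rintro ⟨u, hu, rfl⟩
    rw [mem_stdLattice] at hu
    rw [LinearMap.restrictScalars_apply, Matrix.toLin'_apply, mulVec_hnf]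
    change Valued.v (u 0) ≤ 1 ∧ Valued.v (x * u 0 + p * u 1 - x * u 0) ≤ Valued.v p ∧
      Valued.v ((y * u 0 + z * u 1 + r * u 2 - y * u 0) * p - z * (x * u 0 + p * u 1 - x * u 0)) ≤ Valued.v (p * r)
    refine ⟨hu 0, ?_, ?_⟩
    · have h1 : x * u 0 + p * u 1 - x * u 0 = p * u 1 := by ring
      rw [h1, map_mul]
      exact mul_le_of_le_one_right' (hu 1)
    · have h2 : (y * u 0 + z * u 1 + r * u 2 - y * u 0) * p - z * (x * u 0 + p * u 1 - x * u 0) = p * r * u 2 := by ring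
      rw [h2, map_mul]
      exact mul_le_of_le_one_right' (hu 2)
  · rintro ⟨h0, h1, h2⟩
    refine ⟨![w 0, (w 1 - x * w 0) / p, ((w 2 - y * w 0) - z * ((w 1 - x * w 0) / p)) / r], ?_, ?_⟩
    · rw [mem_stdLattice]
      intro i
      fin_cases i
      · simpa using h0
      · show Valued.v ((w 1 - x * w 0) / p) ≤ 1
        rw [map_div₀, div_le_one₀ hvp]
        exact h1
      · show Valued.v (((w 2 - y * w 0) - z * ((w 1 - x * w 0) / p)) / r) ≤ 1
        have hrew : ((w 2 - y * w 0) - z * ((w 1 - x * w 0) / p)) / r = ((w 2 - y * w 0) * p - z * (w 1 - x * w 0)) / (p * r) := by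
          field_simp
        rw [hrew, map_div₀, div_le_one₀ (by rw [map_mul]; exact mul_pos hvp hvr)]
        exact h2
    · rw [LinearMap.restrictScalars_apply, Matrix.toLin'_apply, mulVec_hnf]
      ext i
      fin_cases i
      · rfl
      · show x * w 0 + p * ((w 1 - x * w 0) / p) = w 1
        field_simp
        ring
      · show y * w 0 + z * ((w 1 - x * w 0) / p) + r * (((w 2 - y * w 0) - z * ((w 1 - x * w 0) / p)) / r) = w 2
        field_simp
        ring

omit [Valued K ℤᵐ⁰] in
/-- The HNF model is invertible (`det V = p·r`). [cite: Serre1980Trees, Ch. II §1.1] -/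
theorem det_hnf (x y z p r : K) : (Matrix.of ![![1, 0, 0], ![x, p, 0], ![y, z, r]]).det = p * r := by
  rw [Matrix.det_fin_three]
  simp

/-! ## §2  `diag(s)`-stability of the HNF lattice -/

omit [Valued K ℤᵐ⁰] in
/-- `Σ_i (s_i − s_j)·w_i·e_i = diag(s − s_j)·w`. [cite: Kottwitz1986BaseChangeUnits, §1 pp. 240–241] -/
theorem sum_smul_single_eq_diagonal_mulVec (s : Fin 3 → K) (j : Fin 3) (w : Fin 3 → K) :
    (∑ i, (s i - s j) • (Pi.single i (w i) : Fin 3 → K)) = (Matrix.diagonal fun i => s i - s j) *ᵥ w := by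
  ext k
  rw [Matrix.mulVec_diagonal, Finset.sum_apply, Finset.sum_eq_single k]
  · rw [Pi.smul_apply, Pi.single_eq_same, smul_eq_mul]
  · intro i _ hik
    rw [Pi.smul_apply, Pi.single_eq_of_ne (Ne.symm hik), smul_zero]
  · exact fun h => (h (Finset.mem_univ k)).elim

/-- **THE STABILITY TEST IS `𝒪`-LINEAR — IT SUFFICES ON THE COLUMNS**: for any matrices `D, V`, `(∀ w ∈ V·𝒪³, D w ∈ V·𝒪³) ↔ ∀ j, D (V e_j) ∈ V·𝒪³`.
[cite: Serre1980Trees, Ch. II §1.1] -/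
theorem forall_mem_latt_mulVec_mem_iff_columns {N : ℕ} (D V : Matrix (Fin N) (Fin N) K) :
    (∀ w ∈ latt V, D *ᵥ w ∈ latt V) ↔ ∀ j, D *ᵥ (V *ᵥ (Pi.single j 1)) ∈ latt V := by
  constructor
  · exact fun h j => h _ (mulVec_single_mem_latt V j)
  · intro h w hw
    obtain ⟨u, hu, rfl⟩ := Submodule.mem_map.1 hw
    rw [LinearMap.restrictScalars_apply, Matrix.toLin'_apply, Matrix.mulVec_mulVec]
    -- `(D V) u = Σ_j u_j • (D V) e_j`
    have hexp : (D * V) *ᵥ u = ∑ j, u j • ((D * V) *ᵥ (Pi.single j 1)) := by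
      conv_lhs => rw [show u = ∑ j, u j • (Pi.single j (1 : K) : Fin N → K) from by
        ext k; simp [Finset.sum_apply, Pi.single_apply]]
      rw [Matrix.mulVec_sum]
      refine Finset.sum_congr rfl fun j _ => ?_
      rw [Matrix.mulVec_smul]
    rw [hexp]
    refine Submodule.sum_mem _ fun j _ => ?_
    have hj : D *ᵥ (V *ᵥ Pi.single j 1) ∈ latt V := h j
    rw [Matrix.mulVec_mulVec] at hj
    exact (latt V).smul_mem (⟨u j, (mem_stdLattice.1 hu) j⟩ : 𝒪[K]) hj

/-- **`diag(s)`-STABILITY OF THE HNF LATTICE IN CLOSED FORM.**  For a unit diagonal `T = diag(s₀, s₁, s₂)` (`|s_i| = 1`) and `V = [[1,0,0],[x,p,0],[y,z,r]]` with `p, r ≠ 0`: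
`T·(V𝒪³) = V𝒪³ ↔ |(s₁ − s₀)·x| ≤ |p| ∧ |(s₁ − s₂)·z| ≤ |r| ∧ |(s₀ − s₂)·y·p + (s₁ − s₀)·x·z| ≤ |p·r|` — ★ p855126's exact criterion
`T·M = M ↔ ∀ w ∈ M, Σ_i (s_i − s₂) w_i e_i ∈ M` read on the three columns `(1,x,y)`, `(0,p,z)`, `(0,0,r)` through §1.  With `p = ϖ^b`, `r = ϖ^c`, `v(s_i − s_j) = n_{ij}` these are
`b ≤ n₀₁ + v(x)`, `c ≤ n₁₂ + v(z)`, `v((s₀−s₂)·y + (s₁−s₀)·x·z·ϖ^{−b}) ≥ c`. [cite: Kottwitz1986BaseChangeUnits, §1 pp. 240–241] [cite: Laumon1995, Lemma (5.3.2) p. 136] -/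
theorem mapGL_diagonal_latt_hnf_eq_iff (s : Fin 3 → K) (hs : ∀ i, Valued.v (s i) = 1) (T : GL (Fin 3) K)
    (hT : (T : Matrix (Fin 3) (Fin 3) K) = Matrix.diagonal s) (x y z : K) {p r : K} (hp : p ≠ 0) (hr : r ≠ 0) :
    mapGL T (latt (Matrix.of ![![1, 0, 0], ![x, p, 0], ![y, z, r]])) = latt (Matrix.of ![![1, 0, 0], ![x, p, 0], ![y, z, r]]) ↔
      Valued.v ((s 1 - s 0) * x) ≤ Valued.v p ∧ Valued.v ((s 1 - s 2) * z) ≤ Valued.v r ∧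
        Valued.v ((s 0 - s 2) * y * p + (s 1 - s 0) * x * z) ≤ Valued.v (p * r) := by
  have hvp : 0 < Valued.v p := (Valuation.pos_iff _).2 hp
  -- valuations of the differences are at most one
  have hd : ∀ i j : Fin 3, Valued.v (s i - s j) ≤ 1 := fun i j =>
    (Valuation.map_sub _ _ _).trans (max_le (hs i).le (hs j).le)
  rw [mapGL_diagonal_eq_iff_sum_single_mem s hs T hT 2]
  simp_rw [sum_smul_single_eq_diagonal_mulVec s 2]
  rw [forall_mem_latt_mulVec_mem_iff_columns]
  -- the three columns and their images under `diag(s − s₂)`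
  have hc0 : (Matrix.diagonal fun i => s i - s 2) *ᵥ ((Matrix.of ![![1, 0, 0], ![x, p, 0], ![y, z, r]]) *ᵥ (Pi.single 0 1)) =
      ![s 0 - s 2, (s 1 - s 2) * x, 0] := by
    rw [mulVec_hnf]; ext i; fin_cases i <;> simp [Matrix.mulVec_diagonal]
  have hc1 : (Matrix.diagonal fun i => s i - s 2) *ᵥ ((Matrix.of ![![1, 0, 0], ![x, p, 0], ![y, z, r]]) *ᵥ (Pi.single 1 1)) =
      ![0, (s 1 - s 2) * p, 0] := by
    rw [mulVec_hnf]; ext i; fin_cases i <;> simp [Matrix.mulVec_diagonal]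
  have hc2 : (Matrix.diagonal fun i => s i - s 2) *ᵥ ((Matrix.of ![![1, 0, 0], ![x, p, 0], ![y, z, r]]) *ᵥ (Pi.single 2 1)) =
      ![0, 0, 0] := by
    rw [mulVec_hnf]; ext i; fin_cases i <;> simp [Matrix.mulVec_diagonal]
  -- the three membership tests, read through §1
  have valuations : ∀ i j : Fin 3, Valued.v (s i - s j) ≤ 1 := hd
  have key : Valued.v ((s 1 - s 2) * z * p) ≤ Valued.v (p * r) ↔ Valued.v ((s 1 - s 2) * z) ≤ Valued.v r := by
    rw [map_mul, map_mul Valued.v p r, mul_comm (Valued.v p) (Valued.v r)]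
    exact mul_le_mul_iff_left₀ hvp
  have m0 : (Matrix.diagonal fun i => s i - s 2) *ᵥ ((Matrix.of ![![1, 0, 0], ![x, p, 0], ![y, z, r]]) *ᵥ (Pi.single 0 1)) ∈
        latt (Matrix.of ![![1, 0, 0], ![x, p, 0], ![y, z, r]]) ↔
      Valued.v ((s 1 - s 0) * x) ≤ Valued.v p ∧ Valued.v ((s 0 - s 2) * y * p + (s 1 - s 0) * x * z) ≤ Valued.v (p * r) := by
    rw [hc0, mem_latt_hnf_iff x y z hp hr]
    have e01 : (![s 0 - s 2, (s 1 - s 2) * x, 0] : Fin 3 → K) 1 - x * (![s 0 - s 2, (s 1 - s 2) * x, 0] : Fin 3 → K) 0 = (s 1 - s 0) * x := by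
      simp; ring
    have e02 : ((![s 0 - s 2, (s 1 - s 2) * x, 0] : Fin 3 → K) 2 - y * (![s 0 - s 2, (s 1 - s 2) * x, 0] : Fin 3 → K) 0) * p -
        z * ((![s 0 - s 2, (s 1 - s 2) * x, 0] : Fin 3 → K) 1 - x * (![s 0 - s 2, (s 1 - s 2) * x, 0] : Fin 3 → K) 0) =
        -((s 0 - s 2) * y * p + (s 1 - s 0) * x * z) := by
      simp; ring
    have e00 : (![s 0 - s 2, (s 1 - s 2) * x, 0] : Fin 3 → K) 0 = s 0 - s 2 := rfl
    rw [e02, e01, e00, Valuation.map_neg]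
    exact ⟨fun h => ⟨h.2.1, h.2.2⟩, fun h => ⟨valuations 0 2, h.1, h.2⟩⟩
  have m1 : (Matrix.diagonal fun i => s i - s 2) *ᵥ ((Matrix.of ![![1, 0, 0], ![x, p, 0], ![y, z, r]]) *ᵥ (Pi.single 1 1)) ∈
        latt (Matrix.of ![![1, 0, 0], ![x, p, 0], ![y, z, r]]) ↔ Valued.v ((s 1 - s 2) * z) ≤ Valued.v r := by
    rw [hc1, mem_latt_hnf_iff x y z hp hr, ← key]
    have e10 : (![0, (s 1 - s 2) * p, 0] : Fin 3 → K) 0 = 0 := rfl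
    have e11 : (![0, (s 1 - s 2) * p, 0] : Fin 3 → K) 1 - x * (![0, (s 1 - s 2) * p, 0] : Fin 3 → K) 0 = (s 1 - s 2) * p := by
      simp
    have e12 : ((![0, (s 1 - s 2) * p, 0] : Fin 3 → K) 2 - y * (![0, (s 1 - s 2) * p, 0] : Fin 3 → K) 0) * p -
        z * ((![0, (s 1 - s 2) * p, 0] : Fin 3 → K) 1 - x * (![0, (s 1 - s 2) * p, 0] : Fin 3 → K) 0) = -((s 1 - s 2) * z * p) := by
      simp; ring
    rw [e12, e11, e10, Valuation.map_neg, map_zero]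
    have t2 : Valued.v ((s 1 - s 2) * p) ≤ Valued.v p := by rw [map_mul]; exact mul_le_of_le_one_left' (valuations 1 2)
    exact ⟨fun h => h.2.2, fun h => ⟨zero_le, t2, h⟩⟩
  have m2 : (Matrix.diagonal fun i => s i - s 2) *ᵥ ((Matrix.of ![![1, 0, 0], ![x, p, 0], ![y, z, r]]) *ᵥ (Pi.single 2 1)) ∈
        latt (Matrix.of ![![1, 0, 0], ![x, p, 0], ![y, z, r]]) := by
    rw [hc2]
    have h0 : (![0, 0, 0] : Fin 3 → K) = 0 := by ext i; fin_cases i <;> rfl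
    rw [h0]
    exact Submodule.zero_mem _
  constructor
  · intro h
    exact ⟨(m0.1 (h 0)).1, m1.1 (h 1), (m0.1 (h 0)).2⟩
  · rintro ⟨h1, h2, h3⟩ j
    fin_cases j
    · exact m0.2 ⟨h1, h3⟩
    · exact m1.2 h2
    · exact m2

/-! ## §3  Normalisation of the HNF lattice -/

/-- An integral HNF model spans a sublattice of `𝒪³`. [cite: Serre1980Trees, Ch. II §1.1] -/
theorem latt_hnf_le_stdLattice {x y z p r : K} (hx : Valued.v x ≤ 1) (hy : Valued.v y ≤ 1) (hz : Valued.v z ≤ 1)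
    (hp : Valued.v p ≤ 1) (hr : Valued.v r ≤ 1) :
    latt (Matrix.of ![![1, 0, 0], ![x, p, 0], ![y, z, r]]) ≤ stdLattice K 3 := by
  rw [latt_le_stdLattice_iff]
  intro i j
  fin_cases i <;> fin_cases j <;> simp [hx, hy, hz, hp, hr]

/-- Slot 0 of the HNF lattice attains a unit (the first column). [cite: Serre1980Trees, Ch. II §1.1] -/
theorem exists_mem_latt_hnf_v_zero_eq_one (x y z p r : K) :
    ∃ w ∈ latt (Matrix.of ![![1, 0, 0], ![x, p, 0], ![y, z, r]]), Valued.v (w 0) = 1 := by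
  refine ⟨_, mulVec_single_mem_latt _ 0, ?_⟩
  rw [mulVec_hnf]
  simp

/-- **SLOT 1 ATTAINS A UNIT iff `|p| = 1 ∨ |x| = 1`** (for integral `x, p`). [cite: Serre1980Trees, Ch. II §1.1] -/
theorem exists_mem_latt_hnf_v_one_eq_one_iff {x p : K} (y z r : K) (hx : Valued.v x ≤ 1) (hp : Valued.v p ≤ 1) :
    (∃ w ∈ latt (Matrix.of ![![1, 0, 0], ![x, p, 0], ![y, z, r]]), Valued.v (w 1) = 1) ↔ Valued.v p = 1 ∨ Valued.v x = 1 := by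
  constructor
  · rintro ⟨w, hw, hw1⟩
    obtain ⟨u, hu, rfl⟩ := Submodule.mem_map.1 hw
    rw [mem_stdLattice] at hu
    rw [LinearMap.restrictScalars_apply, Matrix.toLin'_apply, mulVec_hnf] at hw1
    change Valued.v (x * u 0 + p * u 1) = 1 at hw1
    by_contra hne
    have hx' : Valued.v x < 1 := lt_of_le_of_ne hx fun h => hne (Or.inr h)
    have hp' : Valued.v p < 1 := lt_of_le_of_ne hp fun h => hne (Or.inl h)
    have hlt : Valued.v (x * u 0 + p * u 1) < 1 := by
      refine (Valuation.map_add _ _ _).trans_lt (max_lt ?_ ?_)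
      · rw [map_mul]; exact mul_lt_one_of_lt_of_le hx' (hu 0)
      · rw [map_mul]; exact mul_lt_one_of_lt_of_le hp' (hu 1)
    exact (lt_irrefl _) (hw1 ▸ hlt)
  · rintro (h | h)
    · refine ⟨_, mulVec_single_mem_latt _ 1, ?_⟩
      rw [mulVec_hnf]
      simpa using h
    · refine ⟨_, mulVec_single_mem_latt _ 0, ?_⟩
      rw [mulVec_hnf]
      simpa using h

/-- **SLOT 2 ATTAINS A UNIT iff `|r| = 1 ∨ |y| = 1 ∨ |z| = 1`** (for integral `y, z, r`). [cite: Serre1980Trees, Ch. II §1.1] -/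
theorem exists_mem_latt_hnf_v_two_eq_one_iff (x : K) {y z p r : K} (hy : Valued.v y ≤ 1) (hz : Valued.v z ≤ 1) (hr : Valued.v r ≤ 1) :
    (∃ w ∈ latt (Matrix.of ![![1, 0, 0], ![x, p, 0], ![y, z, r]]), Valued.v (w 2) = 1) ↔
      Valued.v r = 1 ∨ Valued.v y = 1 ∨ Valued.v z = 1 := by
  constructor
  · rintro ⟨w, hw, hw2⟩
    obtain ⟨u, hu, rfl⟩ := Submodule.mem_map.1 hw
    rw [mem_stdLattice] at hu
    rw [LinearMap.restrictScalars_apply, Matrix.toLin'_apply, mulVec_hnf] at hw2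
    change Valued.v (y * u 0 + z * u 1 + r * u 2) = 1 at hw2
    by_contra hne
    have hr' : Valued.v r < 1 := lt_of_le_of_ne hr fun h => hne (Or.inl h)
    have hy' : Valued.v y < 1 := lt_of_le_of_ne hy fun h => hne (Or.inr (Or.inl h))
    have hz' : Valued.v z < 1 := lt_of_le_of_ne hz fun h => hne (Or.inr (Or.inr h))
    have hlt : Valued.v (y * u 0 + z * u 1 + r * u 2) < 1 := by
      refine (Valuation.map_add _ _ _).trans_lt (max_lt ((Valuation.map_add _ _ _).trans_lt (max_lt ?_ ?_)) ?_)
      · rw [map_mul]; exact mul_lt_one_of_lt_of_le hy' (hu 0)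
      · rw [map_mul]; exact mul_lt_one_of_lt_of_le hz' (hu 1)
      · rw [map_mul]; exact mul_lt_one_of_lt_of_le hr' (hu 2)
    exact (lt_irrefl _) (hw2 ▸ hlt)
  · rintro (h | h | h)
    · refine ⟨_, mulVec_single_mem_latt _ 2, ?_⟩
      rw [mulVec_hnf]
      simpa using h
    · refine ⟨_, mulVec_single_mem_latt _ 0, ?_⟩
      rw [mulVec_hnf]
      simpa using h
    · refine ⟨_, mulVec_single_mem_latt _ 1, ?_⟩
      rw [mulVec_hnf]
      simpa using h

/-- **NORMALISATION OF THE HNF LATTICE, PACKAGED** in the currency of the conductor-square count (`∀ i, (∀ w ∈ M, |w i| ≤ 1) ∧ ∃ w ∈ M, |w i| = 1`): for integral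
`x, y, z, p, r`, the lattice `V·𝒪³` is NORMALISED (every coordinate projection is exactly `𝒪`) iff `(|p| = 1 ∨ |x| = 1) ∧ (|r| = 1 ∨ |y| = 1 ∨ |z| = 1)`.
[cite: Kottwitz1986BaseChangeUnits, §1 pp. 240–241] [cite: Serre1980Trees, Ch. II §1.1] -/
theorem normalised_latt_hnf_iff {x y z p r : K} (hx : Valued.v x ≤ 1) (hy : Valued.v y ≤ 1) (hz : Valued.v z ≤ 1)
    (hp : Valued.v p ≤ 1) (hr : Valued.v r ≤ 1) :
    (∀ i : Fin 3, (∀ w ∈ latt (Matrix.of ![![1, 0, 0], ![x, p, 0], ![y, z, r]]), Valued.v (w i) ≤ 1) ∧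
        ∃ w ∈ latt (Matrix.of ![![1, 0, 0], ![x, p, 0], ![y, z, r]]), Valued.v (w i) = 1) ↔
      (Valued.v p = 1 ∨ Valued.v x = 1) ∧ (Valued.v r = 1 ∨ Valued.v y = 1 ∨ Valued.v z = 1) := by
  have hle : ∀ i : Fin 3, ∀ w ∈ latt (Matrix.of ![![1, 0, 0], ![x, p, 0], ![y, z, r]]), Valued.v (w i) ≤ 1 :=
    fun i w hw => (mem_stdLattice.1 (latt_hnf_le_stdLattice hx hy hz hp hr hw)) i
  constructor
  · intro h
    exact ⟨(exists_mem_latt_hnf_v_one_eq_one_iff y z r hx hp).1 (h 1).2, (exists_mem_latt_hnf_v_two_eq_one_iff x hy hz hr).1 (h 2).2⟩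
  · rintro ⟨h1, h2⟩ i
    refine ⟨hle i, ?_⟩
    fin_cases i
    · exact exists_mem_latt_hnf_v_zero_eq_one x y z p r
    · exact (exists_mem_latt_hnf_v_one_eq_one_iff y z r hx hp).2 h1
    · exact (exists_mem_latt_hnf_v_two_eq_one_iff x hy hz hr).2 h2

end Summit.HodgeConjecture.HodgeConjecture.Cruxes.H413.F0P3cDyRamDiagonalStableLatticeHNF

end
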